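import Summits.QuantumFields.YangMills.Theorems.UnitScaleTiltProp7CurvedMemberGradientRow
import Summits.QuantumFields.YangMills.Theorems.UnitScaleTiltProp7MassiveColumnPointwiseDecay
import HarnessLib

/-!
# Route `UnitScaleTilt`, crux K1 «MinimiserStabilityRegPr» (stmt-QuantumFields-19200), EX face — (L3′b)-GRAD FILE **(G1-3b)(ii-c): V6's `hDcol` FROM `RegPr` AND THE LOD LETTERS
# ALONE** — the three VALUE letters `hcol`∕`hpen`∕`hsrc` of ✓`Prop7CurvedMemberGradientRow.column_gradient_decay` ((ii-b), px19 g13) DISCHARGED BY NAME from the chair's V4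
# ✓`Prop7MassiveColumnPointwiseDecay.norm_equiv_massiveColumn_apply_le_decay` (✓p762742), V4a ✓`Prop7MassiveColumnBlockDecay.norm_equiv_penalty_column_le` and V2b
# ✓`Prop7MassiveColumnSupBound.norm_equiv_column_source_le`, at the rate `κ := min μ (1∕4) ∕ 2` of V4's second term (★p1 g25 CHAIR WORD №8 (c) «keep `κ := κ₀∕2`»).

Cell `ym3-torus` (YM ladder rung R3 = continuum SU(2) Yang–Mills on T³ — a RUNG, NOT the Clay problem: not d = 4, not infinite volume, not a mass gap);
width seat `ym3-torus-px19` (gen 13); helper `--supports stmt-QuantumFields-19200`.  THEOREMS ONLY (0 `def`, 0 `sorry`, default heartbeats).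

* §1 `exp_neg_mul_sub_three_le` (`e^{−μ(d−3)} ≤ e^{3μ}·e^{−(κ₀∕2)d}` for `κ₀ ≤ μ`; `e^{−κ₀d} ≤ e^{−(κ₀∕2)d}` is inlined).
* §2 ★★★ `column_gradient_decay_of_regPr` — V6 ✓p763095's `hDcol` BY TEXT with an EXPLICIT constant, under: `RegPr F n K ε₀ U₀` (`10⁷L³ε₀ ≤ 1`), V6's LOD letters
  `hseq hι hT a ha G hAG`, V4's Agmon window `hμ hδ₁ hδ hwin`, the no-wrap room `hroom`, and the absorption margin `hsmall` (print's smallness of `ε₀` against (G1-3a)'s universal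
  constant) — NO value letter left displayed.  Constants: `C_pt := B₁ + B₂` (V4's two letters), `A_pen := V4a's letter · e^{3μ}`, `A_src :=` V2b's letter, all in the member's
  letters exactly as V4 prints them (K-FREE at the pins `c₁ = c₀ℓ³`, as there).
HYP-SAT (★★OWNER RULING №42): every hypothesis is one of V4's∕V6's (inhabited on the literal T³ families as recorded there) or `hroom`∕`hsmall` (CHAIR WORD №1 class ∕ smallness of `ε₀`);
the conclusion is V6's `hDcol`, non-vacuous.  HONEST SCOPE: composition; nothing of V6 §3, `h349`, `hK349`, the ten EX rows, `hT`, `hGF`, EX, `MinimiserStabilityRegPr` (19200) or the rung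
is proved here; the Yang–Mills mass gap is NOT proved.

References: T. Bałaban, CMP **99** (1985) 389–434 [Balaban1985BackgroundPropagators] (Thm 3.1 (3.42)–(3.44) pp.397–398, (3.24) p.394, (3.49) p.399); CMP **95** (1984) 17–40
[Balaban1984PropagatorsI] (p.36).
-/

set_option autoImplicit false

noncomputable section

open scoped BigOperators Matrix.Norms.L2Operator InnerProductSpace ComplexConjugate

namespace Summit.QuantumFields.YangMills.Theorems.Prop7CurvedMemberGradientRowOfRegPr

open Literature.MathematicalPhysics.QuantumFieldTheory.Balaban1983to89
open Literature.MathematicalPhysics.QuantumFieldTheory.Balaban1983to89.T3ContinuumYM3Torus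
open T4Continuum BlockAveraging
open BlockAveraging (Idx)
open B7Prop1Explicit (disp)
open B5Eq118OneStroke (iterBlockOf)
open B10Eq27TorusAxialLog (holT transl)
open B7TransferAnalyticMean (meanCLM)
open B4Sect5Torus (TSite)
open B9Eq311L2Pairing (WL2)
open B11Eq103H1Complex (SiteL2K)
open Summit.QuantumFields.YangMills.Theorems.Prop8Chart (emlIterU)
open T3SectALandauChart (eta bgUnits)
open T3PrintedRegularMinimiser (RegPr)
open T3PrintedRegularOrbits (sites_eq)
open T3LevelShift (siteShift)
open Summit.QuantumFields.YangMills.Theorems.Prop7SectET3Transport (periodsT3 siteEquiv bondEquiv)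
open Summit.QuantumFields.YangMills.Theorems.Prop7SectET3HilbertLetters (W₂ toL2S DL2 covLapSite)
open Summit.QuantumFields.YangMills.Theorems.Prop7CurvedMemberLocalGradient (exists_curved_localGradient)
open Summit.QuantumFields.YangMills.Theorems.AxialGaugeChartGlue (norm_bgOfCfg_axialT_sub_le)
open Summit.QuantumFields.YangMills.Theorems.Prop7CurvedMemberGradientRow (column_gradient_decay)
open Summit.QuantumFields.YangMills.Theorems.Prop7MassiveColumnPointwiseDecay (norm_equiv_massiveColumn_apply_le_decay)
open Summit.QuantumFields.YangMills.Theorems.Prop7MassiveColumnBlockDecay (norm_equiv_penalty_column_le)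
open Summit.QuantumFields.YangMills.Theorems.Prop7MassiveColumnSupBound (norm_equiv_column_source_le)

/-! ## §1 An exponential comparison -/

/-- `e^{−μ(d − 3)} ≤ e^{3μ}·e^{−(κ₀∕2) d}` for `0 ≤ κ₀ ≤ μ`, `d ≥ 0` (`κ₀ = min μ ¼`). [folklore] -/
theorem exp_neg_mul_sub_three_le {μ κ₀ d : ℝ} (hκ : 0 ≤ κ₀) (hκμ : κ₀ ≤ μ) (hd : 0 ≤ d) :
    Real.exp (-(μ * (d - 3))) ≤ Real.exp (3 * μ) * Real.exp (-(κ₀ / 2 * d)) := by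
  rw [← Real.exp_add]
  exact Real.exp_le_exp.mpr (by nlinarith)

/-! ## §2 ★★★ `hDcol` from `RegPr` and the LOD letters -/

variable (F : T3Family) {n K : ℕ} (h : n ≤ K) {c₀ c₁ : ℝ} [Fact (0 < c₀)] [Fact (0 < c₁)]
  {ε₀ : ℝ} (hε₀ : 0 < ε₀) (hε7 : 10 ^ 7 * (F.L : ℝ) ^ 3 * ε₀ ≤ 1)
  (U₀ : GaugeField (F.P K) 0 (Matrix.specialUnitaryGroup (Fin 2) ℂ)) (hreg : RegPr F n K ε₀ U₀)
  (Q'' : SiteL2K ℂ 3 (periodsT3 F K) c₀ W₂ →ₗ[ℂ] (Site (F.P K) (K - n) → Matrix (Fin 2) (Fin 2) ℂ))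
  (hseq : ∀ lam : Site (F.P K) 0 → Matrix (Fin 2) (Fin 2) ℂ, ∃ ns : (j : ℕ) → Site (F.P K) j → Matrix (Fin 2) (Fin 2) ℂ, ns 0 = lam ∧
      (∀ (j : ℕ) (y : Site (F.P K) (j + 1)), ns (j + 1) y = ns j (emb y) - meanCLM (Idx (F.P K)) (Matrix (Fin 2) (Fin 2) ℂ) fun i : Idx (F.P K) =>
        ns j (emb y) - ((holT (emlIterU j (bgUnits F K U₀)) (emb y) (stairWord i.2.1 (off i.1)) : (Matrix (Fin 2) (Fin 2) ℂ)ˣ) : Matrix (Fin 2) (Fin 2) ℂ) *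
          ns j (transl (emb y) (disp (stairWord i.2.1 (off i.1)))) * (((holT (emlIterU j (bgUnits F K U₀)) (emb y) (stairWord i.2.1 (off i.1)))⁻¹ : (Matrix (Fin 2) (Fin 2) ℂ)ˣ) : Matrix (Fin 2) (Fin 2) ℂ)) ∧
      ns (K - n) = Q'' (toL2S F K c₀ lam))
  (ι : (Site (F.P K) (K - n) → Matrix (Fin 2) (Fin 2) ℂ) →ₗ[ℂ] SiteL2K ℂ 3 (periodsT3 F n) c₁ W₂)
  (hι : ∀ c, ι c = toL2S F n c₁ (fun z => c (siteShift (sites_eq F n K h) z)))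
  (T : SiteL2K ℂ 3 (periodsT3 F n) c₁ W₂ →ₗ[ℂ] SiteL2K ℂ 3 (periodsT3 F K) c₀ W₂)
  (hT : ∀ (l : SiteL2K ℂ 3 (periodsT3 F K) c₀ W₂) (f : SiteL2K ℂ 3 (periodsT3 F n) c₁ W₂), ⟪ι (Q'' l), f⟫_ℂ = ⟪l, T f⟫_ℂ)
  {a : ℝ} (ha : 0 < a)

include h hε₀ hε7 hreg hseq hι hT ha in
/-- ★★★ **THE CURVED MEMBER GRADIENT ROW FROM `RegPr` AND THE LOD LETTERS — V6's `hDcol` with NO value letter displayed** ([Balaban1985BackgroundPropagators] Thm 3.1 (3.43)–(3.44)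
for the LOD column at the curved background, K-free at the pins): ✓`column_gradient_decay` ((ii-b)) with `hcol` ⟸ V4 ✓`norm_equiv_massiveColumn_apply_le_decay` (`C_pt := B₁ + B₂`,
`e^{−κ₀d} ≤ e^{−(κ₀∕2)d}`), `hpen` ⟸ V4a ✓`norm_equiv_penalty_column_le` (`e^{−μ(d−3)} ≤ e^{3μ}e^{−(κ₀∕2)d}`), `hsrc` ⟸ V2b ✓`norm_equiv_column_source_le`; rate `κ := min μ ¼ ∕ 2`.
[cite: Balaban1985BackgroundPropagators, Thm 3.1 (3.42)–(3.44) pp.397–398, (3.24) p.394, (3.49) p.399] -/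
theorem column_gradient_decay_of_regPr
    (G : SiteL2K ℂ 3 (periodsT3 F K) c₀ W₂ →ₗ[ℂ] SiteL2K ℂ 3 (periodsT3 F K) c₀ W₂)
    (hAG : ∀ f, covLapSite F n K c₀ U₀ (G f) + (a : ℂ) • T (ι (Q'' (G f))) = f)
    {μ : ℝ} (hμ : 0 < μ) {δ₁ : ℝ} (hδ₁ : 0 ≤ δ₁)
    (hδ : 3 * ((eta F n K)⁻¹) ^ 2 * (Real.exp (μ * eta F n K) - 1) ^ 2 + a * ((25 / 8) * (c₁ * ((((F.P K).L : ℝ) ^ (F.P K).d) ^ (K - n))⁻¹ / c₀)) * (Real.exp (3 * μ) - 1) ^ 2 ≤ δ₁ ^ 2)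
    (hwin : Real.sqrt (max 2 (16 * c₀ * ((F.L : ℝ) ^ (K - n)) ^ 3 / (a * c₁))) * δ₁ ≤ 1 / 10)
    (hroom : 2 * (12 * F.L ^ (K - n) + 5) ≤ (F.P K).sitesPerDir 0)
    (hsmall : exists_curved_localGradient.choose * (48 * ε₀ * (6 * Real.sqrt 2 * Real.sqrt 10 + 6 * Real.sqrt 2)) * Real.exp (51 * (min μ (1 / 4) / 2)) ≤ 1 / 2) :
    ∀ (y : Site (F.P K) (K - n)) (Y : Matrix (Fin 2) (Fin 2) ℂ) (b : PBond (F.P K) 0),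
      ‖WL2.equiv ℂ _ W₂ (DL2 F n K c₀ U₀ (G (T (ι (Pi.single y Y))))) (bondEquiv F K b)‖
        ≤ (2 * (exists_curved_localGradient.choose * ((14 * (8 * Real.exp (3 * min μ (1 / 4)) * ((5 / 4) * Real.sqrt (2 * c₁) * ((((F.P K).L : ℝ) ^ (F.P K).d) ^ (K - n))⁻¹ / c₀ * Real.sqrt (2 * c₁) + Real.exp (3 * μ) * ((a * ((5 / 4) * Real.sqrt (2 * c₁) * ((((F.P K).L : ℝ) ^ (F.P K).d) ^ (K - n))⁻¹ / c₀) * Real.sqrt ((25 / 8) * (c₁ * ((((F.P K).L : ℝ) ^ (F.P K).d) ^ (K - n))⁻¹ / c₀))) * ((8 * Real.sqrt (max 2 (16 * c₀ * ((F.L : ℝ) ^ (K - n)) ^ 3 / (a * c₁))) ^ 2) * (Real.sqrt ((25 / 8) * (c₁ * ((((F.P K).L : ℝ) ^ (F.P K).d) ^ (K - n))⁻¹ / c₀)) * Real.sqrt (2 * c₁)))))) + Real.sqrt (3 ^ 3 / (c₀ * ((F.L : ℝ) ^ (K - n)) ^ 3) * 8) * (Real.sqrt (8 * Real.exp (3 *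 min μ (1 / 4)) * Real.exp (6 * μ) * (2 * (1 + 1 / μ)) ^ 3) * ((8 * Real.sqrt (max 2 (16 * c₀ * ((F.L : ℝ) ^ (K - n)) ^ 3 / (a * c₁))) ^ 2) * (Real.sqrt ((25 / 8) * (c₁ * ((((F.P K).L : ℝ) ^ (F.P K).d) ^ (K - n))⁻¹ / c₀)) * Real.sqrt (2 * c₁))))) * Real.exp (51 * (min μ (1 / 4) / 2)) * (2 + 2 * Real.sqrt 2 * (4 * ε₀ * (3 + 2457 * norm_bgOfCfg_axialT_sub_le.choose)) + (24 * Real.sqrt 10 + 48) * (48 * ε₀) ^ 2) + ((a * ((5 / 4) * Real.sqrt (2 * c₁) * ((((F.P K).L : ℝ) ^ (F.P K).d) ^ (K - n))⁻¹ / c₀) * Real.sqrt ((25 / 8) * (c₁ * ((((F.P K).L : ℝ) ^ (F.P K).d) ^ (K - n))⁻¹ / c₀)) * (Real.exp (3 * μ) * (8 * Real.sqrt (max 2 (16 * c₀ * ((F.L : ℝ) ^ (K - n)) ^ 3 / (a * c₁))) ^ 2) * (Real.sqrt ((25 / 8) * (c₁ * ((((F.P K).L : ℝ) ^ (F.P K).d)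 ^ (K - n))⁻¹ / c₀)) * Real.sqrt (2 * c₁)))) + ((5 / 4) * Real.sqrt (2 * c₁) * ((((F.P K).L : ℝ) ^ (F.P K).d) ^ (K - n))⁻¹ / c₀ * Real.sqrt (2 * c₁))) * Real.exp (51 * (min μ (1 / 4) / 2))) + 2 * Real.sqrt 2 * (48 * ε₀) * ((14 * (8 * Real.exp (3 * min μ (1 / 4)) * ((5 / 4) * Real.sqrt (2 * c₁) * ((((F.P K).L : ℝ) ^ (F.P K).d) ^ (K - n))⁻¹ / c₀ * Real.sqrt (2 * c₁) + Real.exp (3 * μ) * ((a * ((5 / 4) * Real.sqrt (2 * c₁) * ((((F.P K).L : ℝ) ^ (F.P K).d) ^ (K - n))⁻¹ / c₀) * Real.sqrt ((25 / 8) * (c₁ * ((((F.P K).L : ℝ) ^ (F.P K).d) ^ (K - n))⁻¹ / c₀))) * ((8 * Real.sqrt (max 2 (16 * c₀ * ((F.L : ℝ) ^ (K - n)) ^ 3 / (a * c₁))) ^ 2) * (Real.sqrt ((25 / 8) * (c₁ * ((((F.P K).L : ℝ) ^ (F.P K).d) ^ (K - n))⁻¹ / c₀)) * Real.sqrt (2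 * c₁)))))) + Real.sqrt (3 ^ 3 / (c₀ * ((F.L : ℝ) ^ (K - n)) ^ 3) * 8) * (Real.sqrt (8 * Real.exp (3 * min μ (1 / 4)) * Real.exp (6 * μ) * (2 * (1 + 1 / μ)) ^ 3) * ((8 * Real.sqrt (max 2 (16 * c₀ * ((F.L : ℝ) ^ (K - n)) ^ 3 / (a * c₁))) ^ 2) * (Real.sqrt ((25 / 8) * (c₁ * ((((F.P K).L : ℝ) ^ (F.P K).d) ^ (K - n))⁻¹ / c₀)) * Real.sqrt (2 * c₁))))) * Real.exp (51 * (min μ (1 / 4) / 2)))))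
          * Real.exp (-((min μ (1 / 4) / 2) * (Site.tdist (P := F.P K) (iterBlockOf (K - n) b.src) y : ℝ))) * ‖Y‖ := by
  have hc₀ : 0 < c₀ := Fact.out
  have hc₁ : 0 < c₁ := Fact.out
  have hLP := (F.P K).L_pos
  have hL1 : (1 : ℝ) ≤ (F.L : ℝ) := by have := F.hL.2; exact_mod_cast this.le
  have hε1 : ε₀ ≤ 1 := by
    have h1 : (1 : ℝ) ≤ 10 ^ 7 * (F.L : ℝ) ^ 3 := by
      have : (1 : ℝ) ≤ (F.L : ℝ) ^ 3 := one_le_pow₀ hL1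
      nlinarith
    nlinarith
  have hκ0 : 0 ≤ min μ (1 / 4) := le_min hμ.le (by norm_num)
  have hκμ : min μ (1 / 4) ≤ μ := min_le_left _ _
  have hκ : 0 ≤ (min μ (1 / 4) / 2) := by positivity
  -- the three VALUE rows of record
  have hV4 := fun y Y x₀ => norm_equiv_massiveColumn_apply_le_decay F h hε₀ hε7 U₀ hreg Q'' hseq ι hι T hT ha G hAG hμ hδ₁ hδ hwin y Y x₀
  have hDP := fun y Y x => norm_equiv_penalty_column_le F h hε₀ hε7 U₀ hreg Q'' hseq ι hι T hT ha G hAG hμ.le hδ₁ hδ hwin y Y x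
  have hSRC := fun y Y xt => norm_equiv_column_source_le F h hε₀ hε7 U₀ hreg Q'' hseq ι hι T hT y Y xt
  -- nonnegativity of the letters
  have hlv : 0 < ((((F.P K).L : ℝ) ^ (F.P K).d) ^ (K - n))⁻¹ := by positivity
  have hB1 : 0 ≤ 14 * (8 * Real.exp (3 * min μ (1 / 4)) * ((5 / 4) * Real.sqrt (2 * c₁) * ((((F.P K).L : ℝ) ^ (F.P K).d) ^ (K - n))⁻¹ / c₀ * Real.sqrt (2 * c₁) + Real.exp (3 * μ) * ((a * ((5 / 4) * Real.sqrt (2 * c₁) * ((((F.P K).L : ℝ) ^ (F.P K).d) ^ (K - n))⁻¹ / c₀) * Real.sqrt ((25 / 8) * (c₁ * ((((F.P K).L : ℝ) ^ (F.P K).d) ^ (K - n))⁻¹ / c₀))) * ((8 * Real.sqrt (max 2 (16 * c₀ * ((F.L : ℝ) ^ (K - n)) ^ 3 / (a * c₁))) ^ 2) * (Real.sqrt ((25 / 8) * (c₁ * ((((F.P K).L : ℝ) ^ (F.P K).d) ^ (K - n))⁻¹ / c₀)) * Real.sqrt (2 * c₁)))))) := by positivity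
  have hB2 : 0 ≤ Real.sqrt (3 ^ 3 / (c₀ * ((F.L : ℝ) ^ (K - n)) ^ 3) * 8) * (Real.sqrt (8 * Real.exp (3 * min μ (1 / 4)) * Real.exp (6 * μ) * (2 * (1 + 1 / μ)) ^ 3) * ((8 * Real.sqrt (max 2 (16 * c₀ * ((F.L : ℝ) ^ (K - n)) ^ 3 / (a * c₁))) ^ 2) * (Real.sqrt ((25 / 8) * (c₁ * ((((F.P K).L : ℝ) ^ (F.P K).d) ^ (K - n))⁻¹ / c₀)) * Real.sqrt (2 * c₁)))) := by positivity
  have hApen : 0 ≤ (a * ((5 / 4) * Real.sqrt (2 * c₁) * ((((F.P K).L : ℝ) ^ (F.P K).d) ^ (K - n))⁻¹ / c₀) * Real.sqrt ((25 / 8) * (c₁ * ((((F.P K).L : ℝ) ^ (F.P K).d) ^ (K - n))⁻¹ / c₀)) * (Real.exp (3 * μ) * (8 * Real.sqrt (max 2 (16 * c₀ * ((F.L : ℝ) ^ (K - n)) ^ 3 / (a * c₁))) ^ 2) * (Real.sqrt ((25 / 8) * (c₁ * ((((F.P K).L : ℝ) ^ (F.P K).d) ^ (K - n))⁻¹ /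 c₀)) * Real.sqrt (2 * c₁)))) := by positivity
  have hAsrc : 0 ≤ ((5 / 4) * Real.sqrt (2 * c₁) * ((((F.P K).L : ℝ) ^ (F.P K).d) ^ (K - n))⁻¹ / c₀ * Real.sqrt (2 * c₁)) := by positivity
  refine column_gradient_decay F h hε₀ hε1 U₀ hreg Q'' hseq ι hι T hT a G hAG (Cpt := (14 * (8 * Real.exp (3 * min μ (1 / 4)) * ((5 / 4) * Real.sqrt (2 * c₁) * ((((F.P K).L : ℝ) ^ (F.P K).d) ^ (K - n))⁻¹ / c₀ * Real.sqrt (2 * c₁) + Real.exp (3 * μ) * ((a * ((5 / 4) * Real.sqrt (2 * c₁) * ((((F.P K).L : ℝ) ^ (F.P K).d) ^ (K - n))⁻¹ / c₀) * Real.sqrt ((25 / 8) * (c₁ * ((((F.P K).L : ℝ) ^ (F.P K).d) ^ (K - n))⁻¹ / c₀))) * ((8 * Real.sqrt (max 2 (16 * c₀ * ((F.L : ℝ) ^ (K - n)) ^ 3 / (a * c₁))) ^ 2) * (Real.sqrt ((25 / 8) * (c₁ * ((((F.P K).L : ℝ) ^ (F.P K).d) ^ (K - n))⁻¹ / c₀))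 * Real.sqrt (2 * c₁)))))) + Real.sqrt (3 ^ 3 / (c₀ * ((F.L : ℝ) ^ (K - n)) ^ 3) * 8) * (Real.sqrt (8 * Real.exp (3 * min μ (1 / 4)) * Real.exp (6 * μ) * (2 * (1 + 1 / μ)) ^ 3) * ((8 * Real.sqrt (max 2 (16 * c₀ * ((F.L : ℝ) ^ (K - n)) ^ 3 / (a * c₁))) ^ 2) * (Real.sqrt ((25 / 8) * (c₁ * ((((F.P K).L : ℝ) ^ (F.P K).d) ^ (K - n))⁻¹ / c₀)) * Real.sqrt (2 * c₁)))))) (Apen := (a * ((5 / 4) * Real.sqrt (2 * c₁) * ((((F.P K).L : ℝ) ^ (F.P K).d) ^ (K - n))⁻¹ / c₀) * Real.sqrt ((25 / 8) * (c₁ * ((((F.P K).L : ℝ) ^ (F.P K).d) ^ (K - n))⁻¹ / c₀)) * (Real.exp (3 * μ) * (8 * Real.sqrt (max 2 (16 * c₀ * ((F.L : ℝ) ^ (K - n)) ^ 3 / (a * c₁))) ^ 2) * (Real.sqrt ((25 / 8) * (c₁ * ((((F.P K).L : ℝ) ^ (F.P K).d) ^ (K - n))⁻¹ / c₀)) * Real.sqrt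 (2 * c₁))))) (Asrc := ((5 / 4) * Real.sqrt (2 * c₁) * ((((F.P K).L : ℝ) ^ (F.P K).d) ^ (K - n))⁻¹ / c₀ * Real.sqrt (2 * c₁))) (κ := (min μ (1 / 4) / 2))
    (add_nonneg hB1 hB2) hApen hAsrc hκ ?_ ?_ ?_ hroom hsmall
  · -- `hcol` from V4
    intro y Y x₀
    have hd : 0 ≤ (Site.tdist (P := F.P K) (iterBlockOf (K - n) x₀) y : ℝ) := Nat.cast_nonneg _
    have he : Real.exp (-(min μ (1 / 4) * (Site.tdist (P := F.P K) (iterBlockOf (K - n) x₀) y : ℝ)))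
        ≤ Real.exp (-(min μ (1 / 4) / 2 * (Site.tdist (P := F.P K) (iterBlockOf (K - n) x₀) y : ℝ))) :=
      Real.exp_le_exp.mpr (by linarith only [mul_nonneg hκ0 hd])
    refine (hV4 y Y x₀).trans ?_
    have hY : 0 ≤ ‖Y‖ := norm_nonneg _
    have h1 : 14 * (8 * Real.exp (3 * min μ (1 / 4)) * ((5 / 4) * Real.sqrt (2 * c₁) * ((((F.P K).L : ℝ) ^ (F.P K).d) ^ (K - n))⁻¹ / c₀ * Real.sqrt (2 * c₁) + Real.exp (3 * μ) * ((a * ((5 / 4) * Real.sqrt (2 * c₁) * ((((F.P K).L : ℝ) ^ (F.P K).d) ^ (K - n))⁻¹ / c₀) * Real.sqrt ((25 / 8) * (c₁ * ((((F.P K).L : ℝ) ^ (F.P K).d) ^ (K - n))⁻¹ / c₀))) * ((8 * Real.sqrt (max 2 (16 * c₀ * ((F.L : ℝ) ^ (K - n)) ^ 3 / (a * c₁))) ^ 2) * (Real.sqrt ((25 / 8) * (c₁ * ((((F.P K).L : ℝ) ^ (F.P K).d) ^ (K - n))⁻¹ / c₀)) * Real.sqrt (2 * c₁)))))) * Real.exp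 (-(min μ (1 / 4) * (Site.tdist (P := F.P K) (iterBlockOf (K - n) x₀) y : ℝ)))
        ≤ 14 * (8 * Real.exp (3 * min μ (1 / 4)) * ((5 / 4) * Real.sqrt (2 * c₁) * ((((F.P K).L : ℝ) ^ (F.P K).d) ^ (K - n))⁻¹ / c₀ * Real.sqrt (2 * c₁) + Real.exp (3 * μ) * ((a * ((5 / 4) * Real.sqrt (2 * c₁) * ((((F.P K).L : ℝ) ^ (F.P K).d) ^ (K - n))⁻¹ / c₀) * Real.sqrt ((25 / 8) * (c₁ * ((((F.P K).L : ℝ) ^ (F.P K).d) ^ (K - n))⁻¹ / c₀))) * ((8 * Real.sqrt (max 2 (16 * c₀ * ((F.L : ℝ) ^ (K - n)) ^ 3 / (a * c₁))) ^ 2) * (Real.sqrt ((25 / 8) * (c₁ * ((((F.P K).L : ℝ) ^ (F.P K).d) ^ (K - n))⁻¹ / c₀)) * Real.sqrt (2 * c₁)))))) * Real.exp (-((min μ (1 / 4) / 2) * (Site.tdist (P := F.P K) (iterBlockOf (K - n) x₀) y : ℝ))) := mul_le_mul_of_nonneg_left he hB1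
    exact (mul_le_mul_of_nonneg_right (add_le_add h1 le_rfl) hY).trans_eq (by ring)
  · -- `hpen` from V4a
    intro y Y x
    have hd : 0 ≤ (Site.tdist (P := F.P K) (iterBlockOf (K - n) x) y : ℝ) := Nat.cast_nonneg _
    have he := exp_neg_mul_sub_three_le hκ0 hκμ hd
    refine (hDP y Y x).trans ?_
    have hY : 0 ≤ ‖Y‖ := norm_nonneg _
    have hsv : 0 ≤ Real.sqrt ((25 / 8) * (c₁ * ((((F.P K).L : ℝ) ^ (F.P K).d) ^ (K - n))⁻¹ / c₀)) := Real.sqrt_nonneg _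
    have hCP : 0 ≤ 8 * Real.sqrt (max 2 (16 * c₀ * ((F.L : ℝ) ^ (K - n)) ^ 3 / (a * c₁))) ^ 2 := by positivity
    have hpre : 0 ≤ a * ((5 / 4) * Real.sqrt (2 * c₁) * ((((F.P K).L : ℝ) ^ (F.P K).d) ^ (K - n))⁻¹ / c₀) * Real.sqrt ((25 / 8) * (c₁ * ((((F.P K).L : ℝ) ^ (F.P K).d) ^ (K - n))⁻¹ / c₀)) := by positivity
    have h2c : 0 ≤ Real.sqrt (2 * c₁) := Real.sqrt_nonneg _
    calc a * ((5 / 4) * Real.sqrt (2 * c₁) * ((((F.P K).L : ℝ) ^ (F.P K).d) ^ (K - n))⁻¹ / c₀) * Real.sqrt ((25 / 8) * (c₁ * ((((F.P K).L : ℝ) ^ (F.P K).d) ^ (K - n))⁻¹ / c₀)) *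
          (Real.exp (-(μ * ((Site.tdist (iterBlockOf (K - n) x) y : ℝ) - 3))) * (8 * Real.sqrt (max 2 (16 * c₀ * ((F.L : ℝ) ^ (K - n)) ^ 3 / (a * c₁))) ^ 2) * (Real.sqrt ((25 / 8) * (c₁ * ((((F.P K).L : ℝ) ^ (F.P K).d) ^ (K - n))⁻¹ / c₀)) * (Real.sqrt (2 * c₁) * ‖Y‖)))
        ≤ a * ((5 / 4) * Real.sqrt (2 * c₁) * ((((F.P K).L : ℝ) ^ (F.P K).d) ^ (K - n))⁻¹ / c₀) * Real.sqrt ((25 / 8) * (c₁ * ((((F.P K).L : ℝ) ^ (F.P K).d) ^ (K - n))⁻¹ / c₀)) *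
          ((Real.exp (3 * μ) * Real.exp (-((min μ (1 / 4) / 2) * (Site.tdist (P := F.P K) (iterBlockOf (K - n) x) y : ℝ)))) * (8 * Real.sqrt (max 2 (16 * c₀ * ((F.L : ℝ) ^ (K - n)) ^ 3 / (a * c₁))) ^ 2) * (Real.sqrt ((25 / 8) * (c₁ * ((((F.P K).L : ℝ) ^ (F.P K).d) ^ (K - n))⁻¹ / c₀)) * (Real.sqrt (2 * c₁) * ‖Y‖))) := by
          gcongr
      _ = _ := by ring
  · -- `hsrc` from V2b
    intro y Y xt
    exact (hSRC y Y xt).trans_eq (by ring)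

end Summit.QuantumFields.YangMills.Theorems.Prop7CurvedMemberGradientRowOfRegPr

end
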